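import Summits.KontsevichZagierPeriods.Zeta5Search.Barrier.ConeGammaCritBoxRoot
import Summits.KontsevichZagierPeriods.Zeta5Search.Barrier.ConeGammaCritCubic
import Summits.KontsevichZagierPeriods.Zeta5Search.Barrier.ConeGammaCritRootTracking
import Summits.KontsevichZagierPeriods.Zeta5Search.Barrier.ConeGammaLemmaFBoxCert

/-!
# ζ(5) search — BARRIER: CRITICAL VALUES ON BOXES — soundness V: `Regular`, `C₁ ≤ c₁⁺`, `C₀ ≥ c₀⁻` and
# `γ ≤ γ_box` on a direction box

HONEST FRAMING (cell `pub-zeta5`): systematic search; no irrationality claim unless kernel-certified. Theorems only.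
From `critBoxCheck = true` (three Poincaré–Miranda boxes with SEPARATED value enclosures) and P2 g23's
`critVals_aOfS_finite_of_openBox` (at most three critical values on the open box): for EVERY real direction of the
box, `critVals = {v₀, v₁, v₂}` with `v₀ < v₁ < v₂` enclosed, hence `Regular`, `C1 = v₂ ≤ c₁⁺·s₀`, `C0 = v₁ ≥ c₀⁻·s₀`
(`regular_of_critBoxCheck`, `C1_le_of_critBoxCheck`, `C0_ge_of_critBoxCheck`; homogeneity `C0_smul`/`C1_smul`);
and with `gammaCheck = true`, a 5-set minorant of `δ₂₈` (`le_delta28`) and a box bound `Φ ≤ s₀·p/q` (cert-2 g36's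
`phi30_le_boxB_*`, taken as a hypothesis of the stated shape) the tree's `gamma_le_of_bounds` gives
**`gamma a ≤ gnum/gden` for every direction `a` of the box** (`gamma_le_of_critBoxCheck`). Every object is the MODEL
(`C0`, `C1`, `delta28`, `phi30`, `gamma` of `ConeGammaRates` under BZ (28)+(30), (28) observed, not proved); box
bounds are WEAKER than the exact pins at the named centres by construction; nothing about the cone's supremum (C2
OPEN), S-E (CONJECTURED), (TD_A) or `ζ(5)`. Theory seat cert-2 g37.
-/

noncomputable section

open Set

namespace Summit.KontsevichZagierPeriods.Zeta5Search.Barrier.ConeGamma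

namespace CritBox

open Literature.Analysis.ValidatedNumerics (AForm)
open LemmaFBox (SC SC_pos)

/-! ### The three critical values of a box direction -/

/-- A box direction with `t₀ = 1` lies in the OPEN box (`0 < t_j < t₀`) when the box is an open-box box. -/
theorem openBox_of_box {D : ℕ} {lo hi : List ℕ} {t : Fin 8 → ℝ} (hok : boxOKc D lo hi = true)
    (h : t ∈ LemmaFBox.box D lo hi) (ht0 : t 0 = 1) : ∀ j : Fin 7, 0 < t j.succ ∧ t j.succ < t 0 := by
  simp only [boxOKc, decide_eq_true_eq] at hok
  obtain ⟨hD, _, _, _, _, hall⟩ := hok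
  have hD' : (0 : ℝ) < D := by exact_mod_cast hD
  intro j
  obtain ⟨h0, _, hhi⟩ := hall j.val (List.mem_range.2 j.isLt)
  obtain ⟨h1, h2⟩ := h j.succ
  have e : (j.succ : ℕ) = j.val + 1 := rfl
  rw [e] at h1 h2
  have h0' : (0 : ℝ) < ((lo.getD (j.val + 1) 0 : ℕ) : ℝ) := by exact_mod_cast h0
  have hhi' : ((hi.getD (j.val + 1) 0 : ℕ) : ℝ) < D := by exact_mod_cast hhi
  rw [ht0]
  constructor <;> nlinarith

/-- **`critBoxCheck = true` ⇒ the critical values of every box direction are three enclosed numbers.** -/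
theorem critVals_eq_of_critBoxCheck {D T : ℕ} {lo hi : List ℕ} {r0 r1 r2 : RootData} {c0lo c1hi : ℤ} {den : ℕ}
    (hc : critBoxCheck D T lo hi r0 r1 r2 c0lo c1hi den = true) {t : Fin 8 → ℝ} (h : t ∈ LemmaFBox.box D lo hi)
    (ht0 : t 0 = 1) :
    ∃ v₀ v₁ v₂ : ℝ, critVals (aOfS t) = {v₀, v₁, v₂} ∧ v₀ < v₁ ∧ v₁ < v₂ ∧
      (c0lo : ℝ) / den ≤ v₁ ∧ v₂ ≤ (c1hi : ℝ) / den := by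
  unfold critBoxCheck at hc
  split at hc
  · rename_i h0' l1 h1 l2 h2 hr0 hr1 hr2
    simp only [Bool.and_eq_true, decide_eq_true_eq] at hc
    obtain ⟨hok, hT, hden, h01, h12, hC1, hC0⟩ := hc
    obtain ⟨x0, y0, hk0, _, hv0⟩ := exists_isCritical_of_rootCheck hok hT h ht0 hr0
    obtain ⟨x1, y1, hk1, hv1, hv1'⟩ := exists_isCritical_of_rootCheck hok hT h ht0 hr1
    obtain ⟨x2, y2, hk2, hv2, hv2'⟩ := exists_isCritical_of_rootCheck hok hT h ht0 hr2
    set v0 := growthLogR (pR (aOfS t)) (qR (aOfS t)) x0 y0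
    set v1 := growthLogR (pR (aOfS t)) (qR (aOfS t)) x1 y1
    set v2 := growthLogR (pR (aOfS t)) (qR (aOfS t)) x2 y2
    have hSC : (0 : ℝ) < SC := by exact_mod_cast SC_pos
    have hden' : (0 : ℝ) < den := by exact_mod_cast hden
    have h01' : ((h0' : ℤ) : ℝ) < l1 := by exact_mod_cast h01
    have h12' : ((h1 : ℤ) : ℝ) < l2 := by exact_mod_cast h12
    have hlt01 : v0 < v1 := by nlinarith
    have hlt12 : v1 < v2 := by nlinarith
    have hmem : ∀ {x y : ℝ}, IsCritical (aOfS t) x y → growthLogR (pR (aOfS t)) (qR (aOfS t)) x y ∈ critVals (aOfS t) :=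
      fun hk => ⟨_, _, hk, rfl⟩
    have hsub : ({v0, v1, v2} : Set ℝ) ⊆ critVals (aOfS t) := by
      intro v hv
      simp only [Set.mem_insert_iff, Set.mem_singleton_iff] at hv
      rcases hv with rfl | rfl | rfl
      · exact hmem hk0
      · exact hmem hk1
      · exact hmem hk2
    obtain ⟨hfin, hle⟩ := critVals_aOfS_finite_of_openBox (openBox_of_box hok h ht0)
    have hthree : ({v0, v1, v2} : Set ℝ).ncard = 3 :=
      Set.ncard_eq_three.mpr ⟨v0, v1, v2, hlt01.ne, (hlt01.trans hlt12).ne, hlt12.ne, rfl⟩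
    have heq := Set.eq_of_subset_of_ncard_le hsub (by rw [hthree]; exact hle) hfin
    refine ⟨v0, v1, v2, heq.symm, hlt01, hlt12, ?_, ?_⟩
    · have hC0' : (c0lo : ℝ) * SC ≤ l1 * den := by exact_mod_cast hC0
      rw [div_le_iff₀ hden']
      nlinarith
    · have hC1' : (h2 : ℝ) * den ≤ c1hi * SC := by exact_mod_cast hC1
      rw [le_div_iff₀ hden']
      nlinarith
  · exact absurd hc (by simp)

/-- `Regular`, `C₁ ≤ c₁⁺`, `c₀⁻ ≤ C₀` at a box direction `t` (`t₀ = 1`). -/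
theorem bounds_aOfS_of_critBoxCheck {D T : ℕ} {lo hi : List ℕ} {r0 r1 r2 : RootData} {c0lo c1hi : ℤ} {den : ℕ}
    (hc : critBoxCheck D T lo hi r0 r1 r2 c0lo c1hi den = true) {t : Fin 8 → ℝ} (h : t ∈ LemmaFBox.box D lo hi)
    (ht0 : t 0 = 1) :
    Regular (aOfS t) ∧ C1 (aOfS t) ≤ (c1hi : ℝ) / den ∧ (c0lo : ℝ) / den ≤ C0 (aOfS t) ∧ C0 (aOfS t) < C1 (aOfS t) := by
  obtain ⟨v0, v1, v2, heq, h01, h12, hC0, hC1⟩ := critVals_eq_of_critBoxCheck hc h ht0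
  rw [C1_eq_of_critVals_eq_three heq h01 h12, C0_eq_of_critVals_eq_three heq h01 h12]
  exact ⟨regular_of_critVals_eq_three heq h01.ne (h01.trans h12).ne h12.ne, hC1, hC0, h12⟩

/-! ### Transfer to every direction of the box -/

section Transfer
variable {D T : ℕ} {lo hi : List ℕ} {r0 r1 r2 : RootData} {c0lo c1hi : ℤ} {den : ℕ}

/-- The normalised direction `t = s(a)/s₀(a)` of `a` with the box hypothesis lies in the box, with `t₀ = 1`. -/
theorem normalise_mem_box (hok : boxOKc D lo hi = true) {a : Dir} (ha : BZBox a)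
    (hbox : ∀ j : Fin 7, ((lo.getD j.succ 0 : ℕ) : ℝ) ≤ sParam a j.succ / sParam a 0 * D ∧
      sParam a j.succ / sParam a 0 * D ≤ ((hi.getD j.succ 0 : ℕ) : ℝ)) :
    (fun i => sParam a i / sParam a 0) ∈ LemmaFBox.box D lo hi ∧ (fun i => sParam a i / sParam a 0) (0 : Fin 8) = 1 := by
  have h0 : sParam a 0 ≠ 0 := ha.1.ne'
  simp only [boxOKc, decide_eq_true_eq] at hok
  obtain ⟨hD, _, _, hlo0, hhi0, _⟩ := hok
  refine ⟨fun i => ?_, by simp [h0]⟩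
  refine Fin.cases ?_ (fun j => hbox j) i
  simp only [Fin.val_zero, div_self h0, one_mul]
  rw [hlo0, hhi0]
  exact ⟨le_rfl, le_rfl⟩

/-- **`critBoxCheck = true` ⇒ `Regular a`, `C₁(a) ≤ s₀(a)·c₁⁺`, `s₀(a)·c₀⁻ ≤ C₀(a)` for EVERY direction `a` of the
closed positive box whose normalised parameters lie in the box.** -/
theorem bounds_of_critBoxCheck (hc : critBoxCheck D T lo hi r0 r1 r2 c0lo c1hi den = true) {a : Dir}
    (ha : BZBox a)
    (hbox : ∀ j : Fin 7, ((lo.getD j.succ 0 : ℕ) : ℝ) ≤ sParam a j.succ / sParam a 0 * D ∧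
      sParam a j.succ / sParam a 0 * D ≤ ((hi.getD j.succ 0 : ℕ) : ℝ)) :
    Regular a ∧ C1 a ≤ sParam a 0 * ((c1hi : ℝ) / den) ∧ sParam a 0 * ((c0lo : ℝ) / den) ≤ C0 a := by
  have hok : boxOKc D lo hi = true := by
    unfold critBoxCheck at hc; split at hc
    · simp only [Bool.and_eq_true, decide_eq_true_eq] at hc; exact hc.1
    · exact absurd hc (by simp)
  obtain ⟨hmem, ht0⟩ := normalise_mem_box hok ha hbox
  obtain ⟨hreg, hC1, hC0, _⟩ := bounds_aOfS_of_critBoxCheck hc hmem ht0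
  have hs0 : 0 < sParam a 0 := ha.1
  have hn := LemmaFBox.aOfS_normalise ha
  have eR : Regular a ↔ Regular (aOfS fun i => sParam a i / sParam a 0) := by
    conv_lhs => rw [hn]
    exact regular_smul hs0 _
  have e1 : C1 a = sParam a 0 * C1 (aOfS fun i => sParam a i / sParam a 0) := by
    conv_lhs => rw [hn]
    exact C1_smul hs0 _
  have e0 : C0 a = sParam a 0 * C0 (aOfS fun i => sParam a i / sParam a 0) := by
    conv_lhs => rw [hn]
    exact C0_smul hs0 _
  refine ⟨eR.2 hreg, ?_, ?_⟩
  · rw [e1]; exact mul_le_mul_of_nonneg_left hC1 hs0.le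
  · rw [e0]; exact mul_le_mul_of_nonneg_left hC0 hs0.le

/-- `Regular` on the box. -/
theorem regular_of_critBoxCheck (hc : critBoxCheck D T lo hi r0 r1 r2 c0lo c1hi den = true) {a : Dir}
    (ha : BZBox a)
    (hbox : ∀ j : Fin 7, ((lo.getD j.succ 0 : ℕ) : ℝ) ≤ sParam a j.succ / sParam a 0 * D ∧
      sParam a j.succ / sParam a 0 * D ≤ ((hi.getD j.succ 0 : ℕ) : ℝ)) : Regular a :=
  (bounds_of_critBoxCheck hc ha hbox).1

/-- `C₁(a) ≤ s₀(a)·c₁⁺` on the box. -/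
theorem C1_le_of_critBoxCheck (hc : critBoxCheck D T lo hi r0 r1 r2 c0lo c1hi den = true) {a : Dir}
    (ha : BZBox a)
    (hbox : ∀ j : Fin 7, ((lo.getD j.succ 0 : ℕ) : ℝ) ≤ sParam a j.succ / sParam a 0 * D ∧
      sParam a j.succ / sParam a 0 * D ≤ ((hi.getD j.succ 0 : ℕ) : ℝ)) :
    C1 a ≤ sParam a 0 * ((c1hi : ℝ) / den) :=
  (bounds_of_critBoxCheck hc ha hbox).2.1

/-- `s₀(a)·c₀⁻ ≤ C₀(a)` on the box. -/
theorem C0_ge_of_critBoxCheck (hc : critBoxCheck D T lo hi r0 r1 r2 c0lo c1hi den = true) {a : Dir}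
    (ha : BZBox a)
    (hbox : ∀ j : Fin 7, ((lo.getD j.succ 0 : ℕ) : ℝ) ≤ sParam a j.succ / sParam a 0 * D ∧
      sParam a j.succ / sParam a 0 * D ≤ ((hi.getD j.succ 0 : ℕ) : ℝ)) :
    sParam a 0 * ((c0lo : ℝ) / den) ≤ C0 a :=
  (bounds_of_critBoxCheck hc ha hbox).2.2

end Transfer

/-! ### The `δ₂₈` minorant and `γ` on the box -/

/-- The 28 forms at `aOfS t` are the integer linear forms `h28Coef` (`h28_aOfS`). -/
theorem h28_aOfS_eq_featVal (t : Fin 8 → ℝ) (k : Fin 28) :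
    h28 (aOfS t) k = LemmaFBox.featVal (h28Coef k) t := by
  rw [h28_aOfS]
  fin_cases k <;> simp [h28Coef, LemmaFBox.featVal, LemmaFBox.coef, Fin.sum_univ_eight] <;> ring

/-- `δ₂₈(aOfS t) ≥ delta5Lower/D` on the box, for five distinct forms. -/
theorem delta5Lower_le {D : ℕ} {lo hi : List ℕ} {t : Fin 8 → ℝ} (hD : 0 < D) (h : t ∈ LemmaFBox.box D lo hi)
    {s5 : Fin 5 → Fin 28} (hinj : Function.Injective s5) :
    ((delta5Lower lo hi s5 : ℤ) : ℝ) / D ≤ delta28 (aOfS t) := by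
  classical
  have hD' : (0 : ℝ) < D := by exact_mod_cast hD
  have hcard : (Finset.univ.image s5).card = 5 := by
    rw [Finset.card_image_of_injective _ hinj]; simp
  have hle := le_delta28 (aOfS t) hcard
  rw [Finset.sum_image (fun i _ j _ hij => hinj hij)] at hle
  refine le_trans ?_ hle
  rw [div_le_iff₀ hD', Finset.sum_mul, Fin.sum_univ_five]
  simp only [delta5Lower, h28_aOfS_eq_featVal]
  push_cast
  linarith [LemmaFBox.minNum_le h (h28Coef (s5 0)), LemmaFBox.minNum_le h (h28Coef (s5 1)),
    LemmaFBox.minNum_le h (h28Coef (s5 2)), LemmaFBox.minNum_le h (h28Coef (s5 3)),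
    LemmaFBox.minNum_le h (h28Coef (s5 4))]

/-- **`γ ≤ γ_box` ON THE BOX.** From the critical-value certificate, the assembled integer test, and a box bound
`Φ ≤ s₀·p/q` of the stated shape (cert-2 g36's `phi30_le_boxB_*`), the tree's `gamma_le_of_bounds` gives
`gamma a ≤ gnum/gden` for every direction `a` of the closed positive box whose normalised parameters lie in the box. -/
theorem gamma_le_of_critBoxCheck {D T : ℕ} {lo hi : List ℕ} {r0 r1 r2 : RootData} {c0lo c1hi : ℤ} {den : ℕ}
    (hc : critBoxCheck D T lo hi r0 r1 r2 c0lo c1hi den = true) {s5 : Fin 5 → Fin 28} {p : ℤ} {q gnum gden : ℕ}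
    (hg : gammaCheck D lo hi s5 c0lo c1hi den p q gnum gden = true)
    (hΦ : ∀ a : Dir, BZBox a →
      (∀ j : Fin 7, ((lo.getD j.succ 0 : ℕ) : ℝ) ≤ sParam a j.succ / sParam a 0 * D ∧
        sParam a j.succ / sParam a 0 * D ≤ ((hi.getD j.succ 0 : ℕ) : ℝ)) → phi30 a ≤ sParam a 0 * ((p : ℝ) / q))
    {a : Dir} (ha : BZBox a)
    (hbox : ∀ j : Fin 7, ((lo.getD j.succ 0 : ℕ) : ℝ) ≤ sParam a j.succ / sParam a 0 * D ∧
      sParam a j.succ / sParam a 0 * D ≤ ((hi.getD j.succ 0 : ℕ) : ℝ)) :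
    gamma a ≤ (gnum : ℝ) / gden := by
  have hok : boxOKc D lo hi = true := by
    unfold critBoxCheck at hc; split at hc
    · simp only [Bool.and_eq_true, decide_eq_true_eq] at hc; exact hc.1
    · exact absurd hc (by simp)
  simp only [gammaCheck, decide_eq_true_eq] at hg
  obtain ⟨hinj, hden, hq, hD, hgden, hμ, hQ, hγ⟩ := hg
  obtain ⟨hmem, ht0⟩ := normalise_mem_box hok ha hbox
  set t : Fin 8 → ℝ := fun i => sParam a i / sParam a 0 with ht
  obtain ⟨hreg, hC1, hC0, hlt⟩ := bounds_aOfS_of_critBoxCheck hc hmem ht0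
  have hs0 : 0 < sParam a 0 := ha.1
  have hopen := openBox_of_box hok hmem ht0
  -- `Φ` at the normalised direction
  have hBZ : BZBox (aOfS t) := by
    refine ⟨by rw [sParam_aOfS, ht0]; exact one_pos, fun j => ⟨?_, ?_⟩⟩ <;> rw [sParam_aOfS]
    · exact (hopen j).1.le
    · exact (hopen j).2.le
  have hΦt : phi30 (aOfS t) ≤ (p : ℝ) / q := by
    have := hΦ (aOfS t) hBZ (fun j => by
      simp only [sParam_aOfS, ht0, div_one]
      exact ⟨(hmem j.succ).1, (hmem j.succ).2⟩)
    simpa only [sParam_aOfS, ht0, one_mul] using this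
  have hδ := delta5Lower_le hD hmem hinj
  -- real forms of the integer checks
  have hden' : (0 : ℝ) < den := by exact_mod_cast hden
  have hq' : (0 : ℝ) < q := by exact_mod_cast hq
  have hD' : (0 : ℝ) < D := by exact_mod_cast hD
  have hgden' : (0 : ℝ) < gden := by exact_mod_cast hgden
  have hμ' : (0 : ℝ) ≤ (c0lo : ℝ) / den + (delta5Lower lo hi s5 : ℝ) / D - (p : ℝ) / q := by
    have : (0 : ℝ) ≤ (c0lo : ℝ) * D * q + (delta5Lower lo hi s5 : ℝ) * den * q - p * den * D := by
      have h' := (Int.cast_le (R := ℝ)).mpr hμ; push_cast at h'; linarith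
    have e : (c0lo : ℝ) / den + (delta5Lower lo hi s5 : ℝ) / D - (p : ℝ) / q
        = ((c0lo : ℝ) * D * q + (delta5Lower lo hi s5 : ℝ) * den * q - p * den * D) / (den * D * q) := by
      field_simp
    rw [e]; exact div_nonneg this (by positivity)
  have hQ' : (0 : ℝ) < (c1hi : ℝ) / den + (delta5Lower lo hi s5 : ℝ) / D - (p : ℝ) / q := by
    have : (0 : ℝ) < (c1hi : ℝ) * D * q + (delta5Lower lo hi s5 : ℝ) * den * q - p * den * D := by
      have h' := (Int.cast_lt (R := ℝ)).mpr hQ; push_cast at h'; linarith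
    have e : (c1hi : ℝ) / den + (delta5Lower lo hi s5 : ℝ) / D - (p : ℝ) / q
        = ((c1hi : ℝ) * D * q + (delta5Lower lo hi s5 : ℝ) * den * q - p * den * D) / (den * D * q) := by
      field_simp
    rw [e]; exact div_pos this (by positivity)
  have hγ' : ((c1hi : ℝ) / den - (c0lo : ℝ) / den) * gden
      ≤ gnum * ((c1hi : ℝ) / den + (delta5Lower lo hi s5 : ℝ) / D - (p : ℝ) / q) := by
    have : ((c1hi : ℝ) * D * q - c0lo * D * q) * gden
        ≤ gnum * ((c1hi : ℝ) * D * q + (delta5Lower lo hi s5 : ℝ) * den * q - p * den * D) := by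
      have h' := (Int.cast_le (R := ℝ)).mpr hγ; push_cast at h'; linarith
    have e1 : ((c1hi : ℝ) / den - (c0lo : ℝ) / den) * gden = (((c1hi : ℝ) * D * q - c0lo * D * q) * gden) / (den * D * q) := by
      field_simp
    have e2 : (gnum : ℝ) * ((c1hi : ℝ) / den + (delta5Lower lo hi s5 : ℝ) / D - (p : ℝ) / q)
        = (gnum * ((c1hi : ℝ) * D * q + (delta5Lower lo hi s5 : ℝ) * den * q - p * den * D)) / (den * D * q) := by
      field_simp
    rw [e1, e2]
    exact div_le_div_of_nonneg_right this (by positivity)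
  -- assemble
  have hQt : 0 < C1 (aOfS t) + (delta5Lower lo hi s5 : ℝ) / D - (p : ℝ) / q := by linarith
  have hgam := gamma_le_of_bounds hreg hC1 hC0 hδ hΦt hQt hμ'
  have eg : gamma a = gamma (aOfS t) := by
    conv_lhs => rw [LemmaFBox.aOfS_normalise ha]
    exact gamma_smul hs0 _
  rw [eg]
  refine hgam.trans ?_
  rw [div_le_div_iff₀ hQ' hgden']
  linarith

end CritBox

end Summit.KontsevichZagierPeriods.Zeta5Search.Barrier.ConeGamma

end
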